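import Mathlib

/-!
# Pairing lower bound for biorthogonal Floquet pairs (solo-blind, s52; paper §24.49(6)(i))

For the fibre system `w' = M(t) w` the right Floquet function `φ` and the adjoint (left) one `ψ`
have a `t`-independent pairing `p = ⟪ψ(t), B(t) φ(t)⟫`.  Two elementary consequences used in
§24.49: (1) pointwise, `‖ψ(t)‖ ≥ |p| / (‖B‖ ‖φ(t)‖)`; (2) hence the mean-square condition number
`k_F = (⨍‖φ‖² ⨍‖ψ‖²)^{1/2} / |p|` is bounded below by the dynamic range of `‖φ‖` times the
fractions of the period spent near its maximum and minimum (finite-sample form below: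
`c · a_j / a_k ≤ (∑ a)(∑ b)` whenever `b_i ≥ c / a_i`).  This is the rigorous half of the statement
that an intra-period excursion `e^{A}` of the Floquet envelope forces `k_F ≳ e^{A}` up to
polynomial factors (law (E)).
-/

namespace Summit.AnomalousDissipation.AnomalousDissipation.Theorems

open scoped RealInnerProductSpace

/-- Pointwise pairing bound: if `p ≤ |⟪ψ, B φ⟫|` and `‖B‖ ≤ β` then `‖ψ‖ ≥ p / (β ‖φ‖)`. -/
theorem norm_ge_of_pairing {E : Type*} [NormedAddCommGroup E] [InnerProductSpace ℝ E]
    (B : E →L[ℝ] E) (φ ψ : E) {β p : ℝ} (hβ : ‖B‖ ≤ β) (hβ0 : 0 < β)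
    (hp : p ≤ |⟪ψ, B φ⟫|) (hφ : φ ≠ 0) : p / (β * ‖φ‖) ≤ ‖ψ‖ := by
  have hφpos : 0 < ‖φ‖ := norm_pos_iff.mpr hφ
  have hden : 0 < β * ‖φ‖ := mul_pos hβ0 hφpos
  rw [div_le_iff₀ hden]
  have h1 : |⟪ψ, B φ⟫| ≤ ‖ψ‖ * ‖B φ‖ := abs_real_inner_le_norm ψ (B φ)
  have h2 : ‖B φ‖ ≤ β * ‖φ‖ := (B.le_opNorm φ).trans (by gcongr)
  calc p ≤ |⟪ψ, B φ⟫| := hp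
    _ ≤ ‖ψ‖ * ‖B φ‖ := h1
    _ ≤ ‖ψ‖ * (β * ‖φ‖) := by gcongr
    _ = ‖ψ‖ * (β * ‖φ‖) := rfl

/-- Squared form of the pairing bound: `p² / (β² ‖φ‖²) ≤ ‖ψ‖²`. -/
theorem sq_norm_ge_of_pairing {E : Type*} [NormedAddCommGroup E] [InnerProductSpace ℝ E]
    (B : E →L[ℝ] E) (φ ψ : E) {β p : ℝ} (hβ : ‖B‖ ≤ β) (hβ0 : 0 < β) (hp0 : 0 ≤ p)
    (hp : p ≤ |⟪ψ, B φ⟫|) (hφ : φ ≠ 0) : p ^ 2 / (β ^ 2 * ‖φ‖ ^ 2) ≤ ‖ψ‖ ^ 2 := by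
  have h := norm_ge_of_pairing B φ ψ hβ hβ0 hp hφ
  have hφpos : 0 < ‖φ‖ := norm_pos_iff.mpr hφ
  have hden : 0 < β * ‖φ‖ := mul_pos hβ0 hφpos
  have hnn : 0 ≤ p / (β * ‖φ‖) := div_nonneg hp0 hden.le
  have := pow_le_pow_left₀ hnn h 2
  rwa [div_pow, mul_pow] at this

/-- Dynamic-range bound, finite-sample form: if `0 < a i`, `0 ≤ b i` and `c / a i ≤ b i` on a
finite set `s`, then for any `j, k ∈ s`, `c · (a j / a k) ≤ (∑ a)(∑ b)`.  With `a i = ‖φ(tᵢ)‖²`,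
`b i = ‖ψ(tᵢ)‖²`, `c = p²/β²` this reads `k_F² · n² ≥ (max‖φ‖² / min‖φ‖²) / β²`. -/
theorem sum_mul_sum_ge_ratio {ι : Type*} (s : Finset ι) (a b : ι → ℝ) (c : ℝ) (hc : 0 ≤ c)
    (ha : ∀ i ∈ s, 0 < a i) (hb0 : ∀ i ∈ s, 0 ≤ b i) (hb : ∀ i ∈ s, c / a i ≤ b i)
    {j k : ι} (hj : j ∈ s) (hk : k ∈ s) :
    c * (a j / a k) ≤ (∑ i ∈ s, a i) * (∑ i ∈ s, b i) := by
  have hA : a j ≤ ∑ i ∈ s, a i :=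
    Finset.single_le_sum (fun i hi => (ha i hi).le) hj
  have hB : c / a k ≤ ∑ i ∈ s, b i :=
    (hb k hk).trans (Finset.single_le_sum (fun i hi => hb0 i hi) hk)
  have hak : 0 < a k := ha k hk
  have haj : 0 ≤ a j := (ha j hj).le
  have hcak : 0 ≤ c / a k := div_nonneg hc hak.le
  calc c * (a j / a k) = a j * (c / a k) := by ring
    _ ≤ (∑ i ∈ s, a i) * (c / a k) := by gcongr
    _ ≤ (∑ i ∈ s, a i) * (∑ i ∈ s, b i) := by
        gcongr
        exact haj.trans hA

/-- Mean form: with `n = #s`, `c · (a j / a k) / n² ≤ (⨍ a)(⨍ b)` written without averages: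
`c · a j / a k ≤ n² · ((∑ a)/n) · ((∑ b)/n)`. -/
theorem mean_mul_mean_ge_ratio {ι : Type*} (s : Finset ι) (a b : ι → ℝ) (c : ℝ) (hc : 0 ≤ c)
    (ha : ∀ i ∈ s, 0 < a i) (hb0 : ∀ i ∈ s, 0 ≤ b i) (hb : ∀ i ∈ s, c / a i ≤ b i)
    {j k : ι} (hj : j ∈ s) (hk : k ∈ s) :
    c * (a j / a k) ≤
      (s.card : ℝ) ^ 2 * (((∑ i ∈ s, a i) / s.card) * ((∑ i ∈ s, b i) / s.card)) := by
  have hn : (0 : ℝ) < s.card := by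
    have : s.Nonempty := ⟨j, hj⟩
    exact_mod_cast Finset.card_pos.mpr this
  have h := sum_mul_sum_ge_ratio s a b c hc ha hb0 hb hj hk
  have : (s.card : ℝ) ^ 2 * (((∑ i ∈ s, a i) / s.card) * ((∑ i ∈ s, b i) / s.card))
      = (∑ i ∈ s, a i) * (∑ i ∈ s, b i) := by
    field_simp
  rw [this]; exact h

end Summit.AnomalousDissipation.AnomalousDissipation.Theorems
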